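import Literature.MathematicalPhysics.QuantumFieldTheory.Balaban1983to89.Node00.CriticalOnFibreTopCore
import Literature.MathematicalPhysics.QuantumFieldTheory.Balaban1983to89.Node00.TkFirstStepRegionVanishing
import Summits.QuantumFields.YangMills.Theorems.BalabanUVNodesK0VariationalThm1OuterRange
import Summits.QuantumFields.YangMills.Theorems.BalabanUVNodesK0HalvingStepSocket
import Summits.QuantumFields.YangMills.Theorems.BalabanUVNodesN07Prop8StepFlatWitness

/-!
# K0⁷ — [15] SECT. F's ONE-STEP IMPROVEMENT `HalvingStepTop` FROM ITS CORE FORM `HalvingStepTopCore`: the pure-data plaquettes and bonds of the top class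
# are discharged from (7) with the registered floor `2L² ≤ B₃`; stub 1's registered body and K0⁷'s body from the CORE one-pass sentence (n21-c's socket BY NAME)

Cell `pub-ymgap`, seat `pub-ymgap-k0-s1-w3` generation 0 (D-0149 width seat 3∕3 on K0⁷ `stmt-QuantumFields-20541`, V18 stub 1 `stub_prop8StepCoP13`; plan g77∕g78
W-SEAT-START-LIST v3∕v4 row k0-s1; INTENT-2 of 2026-08-27; dag-lead DEDUP-356 GO).  `--kind proof --supports stmt-QuantumFields-20541 --as helper`.  NEW leaf, THEOREMS ONLY
(0 def); CONSUMED BY NAME, nothing modified: this seat's `Node00.CriticalOnFibreTopCore` (`HalvingStepTopCore`, `halvingStepTopCore_of_halvingStepTop`,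
`Sect2.norm_coDivSum_le_of_stencil`, `Sect2.SeqSeparated.shift_mem ∕ unshift_mem`), dag-n07-e module 30 `Node00.CriticalOnFibreTopHalving` (`HalvingStepTop`,
`prop8RegSepTopStep_of_halvingStepTop`), dag-n21-c g7 `K0VariationalThm1OuterRange` (`mem_printedPlaqs_zero_iff_bonds`, `mem_bondsOf_genSet_zero_iff`,
`plaqHol_eq_of_agreeOn_of_mem_printedPlaqs_zero`), dag-n21-c g16 `K0HalvingStepSocket` (`prop8StepCoP_of_halvingStepTop`, `record13SepCoPHBody_of_halvingStepTop23A`), dag-n07-e module 32 `…N07Prop8StepFlatWitness`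
(`halvingStepTop_binders_inhabited_flat`), dag-n11-d
`Node00.TkFirstStepRegionVanishing` (`subset_hullD_self`), def-R FILE 22′ `suppDomOfRecord`, def-P11 FILE 8∕9∕12a (`Sect2.printedPlaqs`, `Sect2.coDivSum`, `Sect2.DataSmall7PTop`,
`Sect2.omegaPlaqsTop ∕ omegaBondsTop`).  [15] = [Balaban1985Variational]; [6] = [Balaban1985RegularSpaces]; [III] = [Balaban1988Convergent].

WHAT THIS FILE PROVES (kernel, sorry-free, standard axioms).
* §0 two torus identities (`(y − e_ν) + e_ν = y`, `(x − e_ν) + e_μ = (x + e_μ) − e_ν`; private).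
* §1 THE PURE-DATA PART OF (8): `mem_printedPlaqs_zero_of_corners` (three corners off `Ω₁` ⇒ printed), ★ `not_mem_printedPlaqs_zero_of_mem_plaqsOf` (no printed plaquette
  meets `Ω_n`, `n ≥ 2`, along a separated index — the corner's neighbours lie in `Ω₁`), ★ `dist1_plaqHol_lt_of_mem_printedPlaqs` (a printed plaquette of the top class is pinned
  data `< δ₀` on the fibre), ★ `norm_coDivSum_le_of_mem_bondsDeep_compl` (a far bond of the support: its `2d` stencil plaquettes are printed and meet the support ⇒ `‖η·D*∂U(b)‖ ≤ d·2δ₀`).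
* §2 ★★ `halvingStepTop_of_core : (∀ ν K Ω, 0 < ν.M₁ → Ω 1 ⊆ Sup ν K Ω) → 2·L² ≤ B₃ → HalvingStepTopCore F N Sup B₃ a₀ a₁ → HalvingStepTop F N Sup B₃ a₀ a₁` — level `0`:
  `δ₀ ≤ B₃δ₀`; level `1` (the corner plaquettes of `Ω₁`): `δ₀ ≤ 2δ₁ ≤ B₃δ₁·L⁻²` — THIS is where the registered floor `2L² ≤ B₃` is spent (n21-c's floor mode
  `two_sq_L_le_of_prop8RegSepTopStep` read forward); levels `≥ 2`: vacuous by §1; far bonds: `8δ₀ < B₃δ₀`.  ★ `halvingStepTop_iff_core`; `suppDomOfRecord_one_subset`; ★ `prop8RegSepTopStep_of_core`.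
* §4 A6: `halvingStepTopCore_binders_inhabited_flat` — the Core token's binder block AND conclusion jointly inhabited (dag-n07-e module 32's flat witness
  `halvingStepTop_binders_inhabited_flat` BY NAME, conclusion restricted).
* §3 K0⁷ BY NAME: ★ `prop8StepCoP_of_core` (V18 stub 1's REGISTERED body `∃ B₃ a₀ a₁, 2L² ≤ B₃ ∧ 0 < a₀ ∧ 0 < a₁ ∧ Prop8RegSepTopStep F 2 suppDom B₃ a₀ a₁` from
  `∃ B₃ a₀ a₁, 2L² ≤ B₃ ∧ 0 < a₀ ∧ 0 < a₁ ∧ HalvingStepTopCore F 2 suppDom B₃ a₀ a₁`), ★ `record13SepCoPHBody_of_core23A` (K0⁷'s body on every family from the CORE one-pass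
  form of stub 1 and stubs 2 ∕ 3ᴬ verbatim — Cʷ″ via n21-c's socket).
REDUCED SIGNATURE (for the skeleton note): stub 1 ⟸ `∀ F, ∃ B₃ a₀ a₁, 2·(F.L)² ≤ B₃ ∧ 0 < a₀ ∧ 0 < a₁ ∧ HalvingStepTopCore F 2 (fun ν K Ω => suppDomOfRecord F ν K Ω) B₃ a₀ a₁`.

HONEST SCOPE ∕ A6.  CONDITIONAL compositions: the antecedent `HalvingStepTopCore …` is the open analytic content of [15] Sect. F at NODE 00's objects (NOT asserted, NOT proved);
its binder block is `HalvingStepTop`'s, inhabited by dag-n07-e module 32 `…N07Prop8StepFlatWitness.halvingStepTop_binders_inhabited_flat` (flat datum), so §2 is not vacuous; what §§1–2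
prove OUTRIGHT is the data bookkeeping (set ∕ stencil geometry on the finite torus + real-number monotonicity).  Count-neutral; K0⁷ ∕ stub 1 NOT closed; N07 NOT discharged; counts unmoved
(28∕28 · 5∕27); one finite 𝕋⁴ programme at fixed ε; R4 closes the conditional finite-𝕋⁴ rung `BalabanLadder.UV` only — the YM mass gap (Clay) is NOT proved by any of this; nothing
continuum ∕ ℝ⁴ ∕ OS.  READING displayed (unchanged): criticality in the CURVE form (`IsCritOnFibre`).  LOCATED (this seat, evidence #20 on 20541, `LOCATED-S5-COLLAR.md`): [15] (144)'s collar
vs the support's one `M₁`-layer — does not touch this file (generic in `Sup`; only `Ω₁ ⊆ Sup` is used).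
-/

noncomputable section

namespace Summit.QuantumFields.YangMills.Theorems.K0HalvingStepOfCore

open scoped Matrix.Norms.L2Operator
open Literature.MathematicalPhysics.QuantumFieldTheory.Balaban1983to89
open Literature.MathematicalPhysics.QuantumFieldTheory.Balaban1983to89.Node00
open Literature.MathematicalPhysics.QuantumFieldTheory.Balaban1983to89.T4Continuum
open Literature.MathematicalPhysics.QuantumFieldTheory.Balaban1983to89.FlowStep
open B15DeterminingSets
open Summit.QuantumFields.YangMills.Theorems.K0VariationalThm1OuterRange (mem_printedPlaqs_zero_iff_bonds mem_bondsOf_genSet_zero_iff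
  plaqHol_eq_of_agreeOn_of_mem_printedPlaqs_zero)
open Summit.QuantumFields.YangMills.Theorems.K0HalvingStepSocket (prop8StepCoP_of_halvingStepTop record13SepCoPHBody_of_halvingStepTop23A)
open Summit.QuantumFields.YangMills.BalabanUVNodes.N07Prop8StepFlatWitness (halvingStepTop_binders_inhabited_flat)

/-! ## §0  Site bookkeeping -/

section Sites

variable {P : Params}

/-- `(y − e_ν) + e_ν = y` on the torus. [cite: Balaban1987RG1, (0.1) p.251 (bookkeeping)] -/
private theorem shift_unshift_site (y : Site P 0) (ν : Fin P.d) : (y.unshift ν).shift ν = y := by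
  funext κ
  by_cases h : κ = ν
  · subst h; simp [Site.shift, Site.unshift]
  · simp [Site.shift, Site.unshift, Function.update_of_ne h]

/-- `(x − e_ν) + e_μ = (x + e_μ) − e_ν` on the torus. [cite: Balaban1987RG1, (0.1) p.251 (bookkeeping)] -/
private theorem unshift_shift_comm_site (x : Site P 0) (μ ν : Fin P.d) : (x.unshift ν).shift μ = (x.shift μ).unshift ν :=
  (Site.unshift_shift_comm x μ ν).symm

end Sites

/-! ## §1  The pure-data plaquettes and bonds of the top class: where (7) gives (8) directly -/

section PureData

variable {F : T4Family} {N : ℕ} [NeZero N]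

/-- **A level-`0` plaquette with three corners off `Ω₁` is a PRINTED (pure-data) plaquette** (def-P11 FILE 8: no bond of it has both endpoints in `Ω₁`;
n21-c's dictionary `mem_printedPlaqs_zero_iff_bonds`). [cite: Balaban1985Variational, (7) p.278 L20–33; Balaban1985RegularSpaces, (1.5) p.77 (bookkeeping)] -/
theorem mem_printedPlaqs_zero_of_corners {K : ℕ} {Ω : ℕ → Set (Site (F.P K) 0)} {k : ℕ} (hk : 0 < k) {q : Plaq (F.P K) 0}
    (h1 : q.src ∉ Ω 1) (h2 : q.src.shift q.μ ∉ Ω 1) (h3 : q.src.shift q.ν ∉ Ω 1) : q ∈ Sect2.printedPlaqs Ω k 0 := by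
  rw [mem_printedPlaqs_zero_iff_bonds Ω hk, mem_bondsOf_genSet_zero_iff Ω hk, mem_bondsOf_genSet_zero_iff Ω hk,
    mem_bondsOf_genSet_zero_iff Ω hk, mem_bondsOf_genSet_zero_iff Ω hk]
  simp only [pts_zero]
  exact ⟨fun h => h1 h.1, fun h => h2 h.1, fun h => h3 h.1, fun h => h1 h.1⟩

/-- **NO PRINTED PLAQUETTE MEETS `Ω_n` FOR `n ≥ 2`** along a separated index: a corner in `Ω_n ⊆ Ω₂` has all its nearest neighbours in `Ω₁`
(`Sect2.SeqSeparated.shift_mem ∕ unshift_mem`), so the two bonds of the plaquette at that corner lie inside `Ω₁` — the plaquette is not pure data.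
[cite: Balaban1985RegularSpaces, (1.3)–(1.5) p.77; Balaban1985Variational, (7) p.278 (bookkeeping)] -/
theorem not_mem_printedPlaqs_zero_of_mem_plaqsOf {K : ℕ} {ν : Stage7Numerics} {M : ℕ} {g : ℕ → ℝ} {k : ℕ} {s : SeqOfRecord F ν M g K k}
    (hsep : Sect2.SeqSeparated ν.M₁ s) (hM₁ : 0 < ν.M₁) {n : ℕ} (h2n : 2 ≤ n) (hnk : n ≤ k) {p : Plaq (F.P K) 0}
    (hp : p ∈ B8Eq17ClassAkV1.plaqsOf (s.Ω n)) : p ∉ Sect2.printedPlaqs s.Ω k 0 := by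
  have hk : 0 < k := by omega
  have h1k : 1 < k := by omega
  have hΩ2 : s.Ω n ⊆ s.Ω 2 := s.chain.Ω_antitone (by norm_num) h2n hnk
  have hΩ1 : s.Ω 2 ⊆ s.Ω 1 := s.chain.Ω_antitone le_rfl one_le_two (by omega)
  -- neighbours of a point of `Ω₂` lie in `Ω₁`
  have hsh : ∀ {x : Site (F.P K) 0}, x ∈ s.Ω 2 → ∀ μ, x.shift μ ∈ s.Ω 1 := fun hx μ => hsep.shift_mem hM₁ le_rfl h1k hx μ
  have hush : ∀ {x : Site (F.P K) 0}, x ∈ s.Ω 2 → ∀ μ, x.unshift μ ∈ s.Ω 1 := fun hx μ => hsep.unshift_mem hM₁ le_rfl h1k hx μ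
  intro hpr
  obtain ⟨hb1, hb2, _, hb4⟩ := (mem_printedPlaqs_zero_iff_bonds s.Ω hk p).1 hpr
  rw [mem_bondsOf_genSet_zero_iff s.Ω hk] at hb1 hb2 hb4
  simp only [pts_zero] at hb1 hb2 hb4
  rcases (B8Eq17ClassAkV1.mem_plaqsOf _ _).1 hp with h | h | h | h
  · exact hb1 ⟨hΩ1 (hΩ2 h), hsh (hΩ2 h) p.μ⟩
  · refine hb1 ⟨?_, hΩ1 (hΩ2 h)⟩
    have := hush (hΩ2 h) p.μ
    rwa [unshift_shift_site] at this
  · refine hb4 ⟨?_, hΩ1 (hΩ2 h)⟩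
    have := hush (hΩ2 h) p.ν
    rwa [unshift_shift_site] at this
  · refine hb2 ⟨?_, hΩ1 (hΩ2 h)⟩
    have := hush (hΩ2 h) p.ν
    rwa [unshift_shift_site] at this

/-- **(8)'s (1.7)-MEMBER AT A PRINTED PLAQUETTE OF THE TOP CLASS IS DATA**: on the fibre of `W` a printed level-`0` plaquette meeting the support reads `U(∂p) = W₀(∂p)`
(n21-c `plaqHol_eq_of_agreeOn_of_mem_printedPlaqs_zero`), and (7) on the top-domain range bounds it by `δ₀`. [cite: Balaban1985Variational, (3),(7) p.278; Balaban1988Convergent, (2.10)–(2.12) p.256 (bookkeeping)] -/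
theorem dist1_plaqHol_lt_of_mem_printedPlaqs {K k : ℕ} (hk : 0 < k) {Ω : ℕ → Set (Site (F.P K) 0)} {Ω₀ : Set (Site (F.P K) 0)} {δ : ℕ → ℝ}
    {W : MSField (F.P K) (SU N)} (h7 : Sect2.DataSmall7PTop (avOfRecord F N K) Ω Ω₀ k δ W) {U : GaugeField (F.P K) 0 (SU N)}
    (hfib : AgreeOn (genSet Ω k) (avgFamily (avOfRecord F N K) U) W) {p : Plaq (F.P K) 0} (hpr : p ∈ Sect2.printedPlaqs Ω k 0)
    (hpΩ₀ : p ∈ B8Eq17ClassAkV1.plaqsOf Ω₀) : dist1 (GaugeField.plaqHol U p) < δ 0 := by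
  rw [plaqHol_eq_of_agreeOn_of_mem_printedPlaqs_zero (avOfRecord F N K) hk hfib hpr]
  exact h7.1 p ⟨hpr, hpΩ₀⟩

/-- **(8)'s (1.9)-MEMBER AT A FAR BOND IS DATA**: for a bond of the support whose endpoints and all their nearest neighbours lie off `Ω₁` (33b's `Sect2.bondsDeep (Ω₁)ᶜ`),
every plaquette of its co-divergence stencil is a printed plaquette meeting the support, hence pinned data `< δ₀`, and `‖η·(D^{η*}_U∂U)(b)‖ ≤ d·2δ₀`
(`Sect2.norm_coDivSum_le_of_stencil`). [cite: Balaban1985RegularSpaces, (1.1)–(1.2) p.76, (1.5),(1.9) p.77; Balaban1985Variational, (7) p.278 (bookkeeping)] -/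
theorem norm_coDivSum_le_of_mem_bondsDeep_compl {K k : ℕ} (hk : 0 < k) {Ω : ℕ → Set (Site (F.P K) 0)} {Ω₀ : Set (Site (F.P K) 0)} {δ : ℕ → ℝ}
    (hδ0 : 0 ≤ δ 0) {W : MSField (F.P K) (SU N)} (h7 : Sect2.DataSmall7PTop (avOfRecord F N K) Ω Ω₀ k δ W) {U : GaugeField (F.P K) 0 (SU N)}
    (hfib : AgreeOn (genSet Ω k) (avgFamily (avOfRecord F N K) U) W) {b : PBond (F.P K) 0} (hb : b ∈ bondsOf Ω₀)
    (hbd : b ∈ Sect2.bondsDeep (Ω 1)ᶜ) : ‖Sect2.coDivSum U b.src b.dir‖ ≤ (F.P K).d * (2 * δ 0) := by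
  obtain ⟨hx, hxμ, hnb⟩ := hbd
  have hxμ' : b.src.shift b.dir ∉ Ω 1 := hxμ
  have hx' : b.src ∉ Ω 1 := hx
  -- every stencil plaquette is printed and meets `Ω₀`, so it is pinned data `< δ₀`
  have key : ∀ q : Plaq (F.P K) 0, q.src ∉ Ω 1 → q.src.shift q.μ ∉ Ω 1 → q.src.shift q.ν ∉ Ω 1 → q ∈ B8Eq17ClassAkV1.plaqsOf Ω₀ →
      dist1 (GaugeField.plaqHol U q) ≤ δ 0 := fun q h1 h2 h3 hq =>
    (dist1_plaqHol_lt_of_mem_printedPlaqs hk h7 hfib (mem_printedPlaqs_zero_of_corners hk h1 h2 h3) hq).le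
  have hbΩ₀ : b.src ∈ Ω₀ ∨ b.src.shift b.dir ∈ Ω₀ := hb
  refine Sect2.norm_coDivSum_le_of_stencil U hδ0 b.src b.dir (fun ν h => ⟨?_, ?_⟩) (fun ν h => ⟨?_, ?_⟩)
  · -- `p_{νμ}(x − e_ν)`: corners `x − e_ν`, `x`, `(x + e_μ) − e_ν`, `x + e_μ`
    refine key ⟨b.src.unshift ν, ν, b.dir, h⟩ (hnb ν).2.1 ?_ ?_ ?_
    · show (b.src.unshift ν).shift ν ∉ Ω 1
      rw [shift_unshift_site]; exact hx'
    · show (b.src.unshift ν).shift b.dir ∉ Ω 1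
      rw [unshift_shift_comm_site]; exact (hnb ν).2.2.2
    · rcases hbΩ₀ with h0 | h0
      · exact Or.inr (Or.inl (by show (b.src.unshift ν).shift ν ∈ Ω₀; rw [shift_unshift_site]; exact h0))
      · refine Or.inr (Or.inr (Or.inr ?_))
        show ((b.src.unshift ν).shift ν).shift b.dir ∈ Ω₀
        rw [shift_unshift_site]; exact h0
  · -- `p_{νμ}(x)`: corners `x`, `x + e_ν`, `x + e_μ`
    refine key ⟨b.src, ν, b.dir, h⟩ hx' (hnb ν).1 hxμ' ?_
    rcases hbΩ₀ with h0 | h0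
    · exact Or.inl h0
    · exact Or.inr (Or.inr (Or.inl h0))
  · -- `p_{μν}(x − e_ν)`: corners `x − e_ν`, `(x + e_μ) − e_ν`, `x`, `x + e_μ`
    refine key ⟨b.src.unshift ν, b.dir, ν, h⟩ (hnb ν).2.1 ?_ ?_ ?_
    · show (b.src.unshift ν).shift b.dir ∉ Ω 1
      rw [unshift_shift_comm_site]; exact (hnb ν).2.2.2
    · show (b.src.unshift ν).shift ν ∉ Ω 1
      rw [shift_unshift_site]; exact hx'
    · rcases hbΩ₀ with h0 | h0
      · refine Or.inr (Or.inr (Or.inl ?_))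
        show (b.src.unshift ν).shift ν ∈ Ω₀
        rw [shift_unshift_site]; exact h0
      · refine Or.inr (Or.inr (Or.inr ?_))
        show ((b.src.unshift ν).shift b.dir).shift ν ∈ Ω₀
        rw [unshift_shift_comm_site, shift_unshift_site]; exact h0
  · -- `p_{μν}(x)`: corners `x`, `x + e_μ`, `x + e_ν`
    refine key ⟨b.src, b.dir, ν, h⟩ hx' hxμ' (hnb ν).1 ?_
    rcases hbΩ₀ with h0 | h0
    · exact Or.inl h0
    · exact Or.inr (Or.inl h0)

end PureData

/-! ## §2  ★★ `HalvingStepTop` FROM ITS CORE (the registered floor `2L² ≤ B₃`, the support containing `Ω₁`) -/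

section Main

variable {F : T4Family} {N : ℕ} [NeZero N]

/-- ★★ **[15] SECT. F's ONE-STEP IMPROVEMENT AT THE OBJECTS OF RECORD FROM ITS CORE FORM**: if the top domain contains `Ω₁` (the support of record does,
`suppDomOfRecord_one_subset`) and `B₃` carries the registered floor `2L² ≤ B₃`, then `HalvingStepTopCore F N Sup B₃ a₀ a₁` (the one-step conclusion at the
plaquettes with a bond inside `Ω₁` and at the bonds whose stencil meets `Ω₁`) gives `HalvingStepTop F N Sup B₃ a₀ a₁` (the conclusion at EVERY plaquette ∕ bond of
the top class).  The complement is pure data: a printed level-`0` plaquette of the top class is pinned to `W₀` on the fibre and (7) bounds it by `δ₀ ≤ B₃δ₀` (level `0`)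
resp. `δ₀ ≤ 2δ₁ ≤ B₃δ₁·L⁻²` (level `1` — the corner plaquettes of `Ω₁`; THIS is where the floor `2L² ≤ B₃` is spent, cf. n21-c's floor mode
`two_sq_L_le_of_prop8RegSepTopStep`); no printed plaquette meets `Ω_n`, `n ≥ 2` (separation); a far bond's co-divergence reads `2d` pinned plaquettes, `≤ 8δ₀ < B₃δ₀`.
[cite: Balaban1985Variational, Sect. F p.304, (2),(3),(7),(8) p.278, Prop. 8 p.304; Balaban1985RegularSpaces, (1.2) p.76, (1.3)–(1.9) p.77; Balaban1988Convergent, (2.10)–(2.12) p.256] -/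
theorem halvingStepTop_of_core {Sup : (ν : Stage7Numerics) → (K : ℕ) → (ℕ → Set (Site (F.P K) 0)) → Set (Site (F.P K) 0)} {B₃ a₀ a₁ : ℝ}
    (hSup : ∀ (ν : Stage7Numerics) (K : ℕ) (Ω : ℕ → Set (Site (F.P K) 0)), 0 < ν.M₁ → Ω 1 ⊆ Sup ν K Ω)
    (hB₃ : 2 * (F.L : ℝ) ^ 2 ≤ B₃) (h : HalvingStepTopCore F N Sup B₃ a₀ a₁) : HalvingStepTop F N Sup B₃ a₀ a₁ := by
  intro ν M g K k s hsep hM₁ hk ε δ hδ hcomp hcomp' hε hεcomp hεcomp' W h7 U h17 h19 hfib hcrit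
  obtain ⟨hP, hD⟩ := h ν M g K k s hsep hM₁ hk ε δ hδ hcomp hcomp' hε hεcomp hεcomp' W h7 U h17 h19 hfib hcrit
  have hk0 : 0 < k := hk
  have hL11 : (11 : ℝ) < F.L := by exact_mod_cast F.hL11
  have hB₃8 : (8 : ℝ) < B₃ := by nlinarith
  have hB₃1 : (1 : ℝ) ≤ B₃ := by linarith
  have hδ0 : 0 < δ 0 := (hδ 0 (Nat.zero_le _)).1
  have hΩ1Sup : s.Ω 1 ⊆ Sup ν K s.Ω := hSup ν K s.Ω hM₁
  -- the plaquette set of the top class at level `n` lies in `plaqsOf (Sup ν K s.Ω)`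
  have hplaqs : ∀ n, n ≤ k → Sect2.omegaPlaqsTop s.Ω (Sup ν K s.Ω) n ⊆ B8Eq17ClassAkV1.plaqsOf (Sup ν K s.Ω) := by
    intro n hn p hp
    rcases Nat.eq_zero_or_pos n with rfl | hn0
    · rwa [Sect2.omegaPlaqsTop_zero] at hp
    · rw [Sect2.omegaPlaqsTop_of_ne_zero _ _ hn0.ne', omegaPlaqs_of_ne_zero _ hn0.ne'] at hp
      exact B8Eq17ClassAkV1.plaqsOf_mono ((s.chain.Ω_antitone le_rfl hn0 hn).trans hΩ1Sup) hp
  refine ⟨fun n hn p hp => ?_, fun n hn b hb => ?_⟩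
  · -- (1.7) member
    by_cases hpr : p ∈ Sect2.printedPlaqs s.Ω k 0
    swap
    · exact hP n hn p hp hpr
    have hdata : dist1 (GaugeField.plaqHol U p) < δ 0 := dist1_plaqHol_lt_of_mem_printedPlaqs hk0 h7 hfib hpr (hplaqs n hn hp)
    have hηn : 0 ≤ (F.P K).eta n := (pow_pos (inv_pos.mpr (Nat.cast_pos.mpr (F.P K).L_pos)) n).le
    rcases Nat.lt_or_ge n 2 with hn2 | hn2
    · interval_cases n
      · -- level 0: `δ₀ ≤ B₃δ₀`
        have hη0 : (F.P K).eta 0 = 1 := by simp [Params.eta]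
        rw [hη0, one_pow, mul_one]
        calc dist1 (GaugeField.plaqHol U p) < δ 0 := hdata
          _ ≤ B₃ * δ 0 := le_mul_of_one_le_left hδ0.le hB₃1
          _ ≤ max (B₃ * δ 0) (ε 0 / 2) := le_max_left _ _
      · -- level 1: `δ₀ ≤ 2δ₁ ≤ B₃δ₁·L⁻²` (the floor `2L² ≤ B₃`)
        have hδ1 : 0 < δ 1 := (hδ 1 hn).1
        have hc : δ 0 ≤ 2 * δ 1 := hcomp 0 hk0
        have hη1 : (F.P K).eta 1 = (F.L : ℝ)⁻¹ := by simp [Params.eta]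
        have hLpos : (0 : ℝ) < F.L := by linarith
        rw [hη1]
        have hkey : 2 * δ 1 ≤ max (B₃ * δ 1) (ε 1 / 2) * (F.L : ℝ)⁻¹ ^ 2 := by
          calc 2 * δ 1 = (2 * (F.L : ℝ) ^ 2 * δ 1) * (F.L : ℝ)⁻¹ ^ 2 := by field_simp
            _ ≤ (B₃ * δ 1) * (F.L : ℝ)⁻¹ ^ 2 := by gcongr
            _ ≤ max (B₃ * δ 1) (ε 1 / 2) * (F.L : ℝ)⁻¹ ^ 2 := by gcongr; exact le_max_left _ _
        linarith
    · -- levels `n ≥ 2`: no printed plaquette meets `Ω_n`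
      exfalso
      rw [Sect2.omegaPlaqsTop_of_ne_zero _ _ (by omega), omegaPlaqs_of_ne_zero _ (by omega)] at hp
      exact not_mem_printedPlaqs_zero_of_mem_plaqsOf hsep hM₁ hn2 hn hp hpr
  · -- (1.9) member
    by_cases hbd : b ∈ Sect2.bondsDeep (s.Ω 1)ᶜ
    swap
    · exact hD n hn b hb hbd
    rcases Nat.eq_zero_or_pos n with rfl | hn0
    · -- level 0: a far bond of the support reads pinned data on its whole stencil
      rw [Sect2.omegaBondsTop_zero] at hb
      have hη0 : (F.P K).eta 0 = 1 := by simp [Params.eta]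
      rw [hη0, one_pow, mul_one]
      have hle := norm_coDivSum_le_of_mem_bondsDeep_compl hk0 hδ0.le h7 hfib hb hbd
      rw [T4Family.P_d] at hle
      push_cast at hle
      calc ‖Sect2.coDivSum U b.src b.dir‖ ≤ 4 * (2 * δ 0) := hle
        _ < B₃ * δ 0 := by nlinarith
        _ ≤ max (B₃ * δ 0) (ε 0 / 2) := le_max_left _ _
    · -- levels `n ≥ 1`: a bond meeting `Ω_n ⊆ Ω₁` is not far
      exfalso
      rw [Sect2.omegaBondsTop_of_ne_zero _ _ hn0.ne'] at hb
      have hb' : b ∈ bondsOf (s.Ω n) := by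
        unfold Sect2.omegaBonds at hb; rwa [if_neg hn0.ne'] at hb
      have hΩn1 : s.Ω n ⊆ s.Ω 1 := s.chain.Ω_antitone le_rfl hn0 hn
      rcases hb' with h1 | h1
      · exact hbd.1 (hΩn1 h1)
      · exact hbd.2.1 (hΩn1 h1)

/-- ★ **EQUIVALENCE** (for `2L² ≤ B₃` and a top domain containing `Ω₁`): the core form IS the one-step fact — nothing weakened or smuggled; what it buys is that a
discharger (or an ∃-gauge letter token of the S6 assembly) meets obligations only where print's analysis acts. [cite: Balaban1985Variational, Sect. F p.304, Prop. 8 p.304 (bookkeeping)] -/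
theorem halvingStepTop_iff_core {Sup : (ν : Stage7Numerics) → (K : ℕ) → (ℕ → Set (Site (F.P K) 0)) → Set (Site (F.P K) 0)} {B₃ a₀ a₁ : ℝ}
    (hSup : ∀ (ν : Stage7Numerics) (K : ℕ) (Ω : ℕ → Set (Site (F.P K) 0)), 0 < ν.M₁ → Ω 1 ⊆ Sup ν K Ω)
    (hB₃ : 2 * (F.L : ℝ) ^ 2 ≤ B₃) : HalvingStepTop F N Sup B₃ a₀ a₁ ↔ HalvingStepTopCore F N Sup B₃ a₀ a₁ :=
  ⟨halvingStepTopCore_of_halvingStepTop, halvingStepTop_of_core hSup hB₃⟩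

/-- **THE SUPPORT OF RECORD CONTAINS `Ω₁`** ([III] p.255: «the domain Ω₁, or rather a small neighborhood of Ω₁ …»; `suppDomOfRecord = hullD … ν.M₁ 1 (Ω 1)`,
`subset_hullD_self` BY NAME, `0 < M₁`). [cite: Balaban1988Convergent, p.255 (bookkeeping)] -/
theorem suppDomOfRecord_one_subset (F : T4Family) (ν : Stage7Numerics) (K : ℕ) (Ω : ℕ → Set (Site (F.P K) 0)) (hM₁ : 0 < ν.M₁) :
    Ω 1 ⊆ suppDomOfRecord F ν K Ω :=
  subset_hullD_self (F.P K) ν.M₁ hM₁ 1 (Ω 1)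

/-- **[15] PROPOSITION 8's TOP STEP FROM THE CORE ONE-STEP FACT** at the support of record (module 30's iteration `prop8RegSepTopStep_of_halvingStepTop` after
`halvingStepTop_of_core`; `0 < B₃` from the floor). [cite: Balaban1985Variational, Prop. 8 p.304, Sect. F pp.300–304] -/
theorem prop8RegSepTopStep_of_core {B₃ a₀ a₁ : ℝ} (hB₃ : 2 * (F.L : ℝ) ^ 2 ≤ B₃)
    (h : HalvingStepTopCore F N (fun ν K Ω => suppDomOfRecord F ν K Ω) B₃ a₀ a₁) :
    Prop8RegSepTopStep F N (fun ν K Ω => suppDomOfRecord F ν K Ω) B₃ a₀ a₁ := by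
  have hL11 : (11 : ℝ) < F.L := by exact_mod_cast F.hL11
  have hB₃0 : 0 < B₃ := by nlinarith
  exact prop8RegSepTopStep_of_halvingStepTop hB₃0
    (halvingStepTop_of_core (fun ν K Ω hM₁ => suppDomOfRecord_one_subset F ν K Ω hM₁) hB₃ h)

end Main

/-! ## §3  K0⁷: stub 1's registered body and K0⁷'s body from the CORE one-pass sentence (n21-c's socket BY NAME) -/

section K0

/-- ★ **V18 STUB 1's REGISTERED BODY FROM THE CORE ONE-PASS SENTENCE** (`N = 2`, the support of record): a seat landing
`∃ B₃ a₀ a₁, 2L² ≤ B₃ ∧ 0 < a₀ ∧ 0 < a₁ ∧ HalvingStepTopCore F 2 suppDom B₃ a₀ a₁` closes `stub_prop8StepCoP13` in one line (n21-c's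
`K0HalvingStepSocket.prop8StepCoP_of_halvingStepTop` after `halvingStepTop_of_core`).  CONDITIONAL: the antecedent is the open analytic content of [15] Sect. F.
[cite: Balaban1985Variational, Prop. 8 p.304, Sect. F pp.300–304, Thm 1 (7)–(8) pp.278–279 (bookkeeping)] -/
theorem prop8StepCoP_of_core (F : T4Family)
    (h : ∃ B₃ a₀ a₁ : ℝ, 2 * (F.L : ℝ) ^ 2 ≤ B₃ ∧ 0 < a₀ ∧ 0 < a₁ ∧
      HalvingStepTopCore F 2 (fun ν K Ω => suppDomOfRecord F ν K Ω) B₃ a₀ a₁) :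
    ∃ B₃ a₀ a₁ : ℝ, 2 * (F.L : ℝ) ^ 2 ≤ B₃ ∧ 0 < a₀ ∧ 0 < a₁ ∧ Prop8RegSepTopStep F 2 (fun ν K Ω => suppDomOfRecord F ν K Ω) B₃ a₀ a₁ := by
  obtain ⟨B₃, a₀, a₁, hB₃, ha₀, ha₁, h⟩ := h
  exact ⟨B₃, a₀, a₁, hB₃, ha₀, ha₁, prop8RegSepTopStep_of_core hB₃ h⟩

/-- **K0⁷'s BODY AT EVERY FAMILY FROM THE CORE ONE-PASS FORM OF STUB 1, STUBS 2 AND 3ᴬ VERBATIM** (n21-c's Cʷ″ socket `record13SepCoPHBody_of_halvingStepTop23A` after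
`halvingStepTop_of_core`).  CONDITIONAL composition; K0⁷ NOT closed here; nothing of Bałaban asserted.
[cite: Balaban1985Variational, Sect. F pp.300–304, Prop. 8 p.304; Balaban1985RegularSpaces, Prop. 6 p.99; Balaban1988Convergent, Thm 1 p.262; Balaban1987RG1, Thm 1 p.259, §1 p.264 (bookkeeping)] -/
theorem record13SepCoPHBody_of_core23A
    (h1 : ∀ F : T4Family, ∃ B₃ a₀ a₁ : ℝ, 2 * (F.L : ℝ) ^ 2 ≤ B₃ ∧ 0 < a₀ ∧ 0 < a₁ ∧
      HalvingStepTopCore F 2 (fun ν K Ω => suppDomOfRecord F ν K Ω) B₃ a₀ a₁)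
    (h2 : ∀ F : T4Family, ∃ B₁ c₁ : ℝ, 0 ≤ B₁ ∧ 0 < c₁ ∧
      (letI : CStarAlgebra (MatA 2) := {}; B8.Prop6Printed 4 (F.L : ℝ) B₁ c₁ (fun i : B8LeafModelZd.ZdIdx 4 F.L => zdCub (MatA 2) F.L i)))
    (h3A : ∀ (F : T4Family) (B₃ B₃' a₀ a₁ : ℝ), 2 * (F.L : ℝ) ^ 2 ≤ B₃ → 0 < B₃' → 0 < a₀ → 0 < a₁ →
      VariationalThm1RegSepCoP7M F 2 B₃ a₀ a₁ →
      Gauge9RegSepTopStepR F 2 (fun ν K Ω => suppDomOfRecord F ν K Ω) (F.L ^ 3) ((11 * 4 + 3 * F.L) * F.L) B₃ B₃' a₀ a₁ →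
      ∃ γ₀ ε₀ ε₂₉ β' : ℝ, 0 < γ₀ ∧ 0 < ε₀ ∧ 0 < ε₂₉ ∧
        BetaLowerH (-β') γ₀ (betaOfRecord₁₃ F 2 (theta13OfThm1CCM F 2 3 ε₀ ε₂₉ B₃ B₃' a₀ a₁)) ∧
        BetaUpperH β' γ₀ (betaOfRecord₁₃ F 2 (theta13OfThm1CCM F 2 3 ε₀ ε₂₉ B₃ B₃' a₀ a₁))) :
    ∀ F : T4Family, ∃ θ : Stage13HParams F 2, θ.Provisos₁₃SepCoPH F 2 ∧ (θ.ZhUnity F 2 ∧ θ.SlotsNondegenerate₁₃ F 2) ∧ θ.Admissible F 2 :=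
  record13SepCoPHBody_of_halvingStepTop23A (fun F => by
    obtain ⟨B₃, a₀, a₁, hB₃, ha₀, ha₁, h⟩ := h1 F
    have hL11 : (11 : ℝ) < F.L := by exact_mod_cast F.hL11
    exact ⟨B₃, a₀, a₁, by nlinarith, ha₀, ha₁,
      halvingStepTop_of_core (fun ν K Ω hM₁ => suppDomOfRecord_one_subset F ν K Ω hM₁) hB₃ h⟩) h2 h3A

end K0

/-! ## §4  A6: the CORE token's binder block and conclusion are jointly inhabited (the flat datum, dag-n07-e module 32 BY NAME) -/

section Witness

variable (F : T4Family) (N : ℕ) [NeZero N]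

/-- **NON-VACUITY OF THE CORE TOKEN's SHAPE** (A6): for every top domain `Sup`, constants `B₃ > 0`, `a₀, a₁ > 0`, numerics with `0 < M₁`, `M ≥ 1`, any `g`, `K`, `k ≥ 1`,
there are an index `s`, radii `ε`, thresholds `δ`, a datum `W` and a configuration `U` meeting ALL binders of `HalvingStepTopCore` AND its (restricted) conclusion — dag-n07-e's flat
witness `halvingStepTop_binders_inhabited_flat` (separated top index, `W ≡ 1`, `U ≡ 1`) with the conclusion restricted.  (The token itself — the ∀-statement — is [15] Sect. F's
content and is NOT asserted.) [cite: Balaban1985Variational, Sect. F p.304, (2),(7) p.278 (bookkeeping)] -/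
theorem halvingStepTopCore_binders_inhabited_flat
    (Sup : (ν : Stage7Numerics) → (K : ℕ) → (ℕ → Set (Site (F.P K) 0)) → Set (Site (F.P K) 0)) {B₃ a₀ a₁ : ℝ} (hB₃ : 0 < B₃) (ha₀ : 0 < a₀)
    (ha₁ : 0 < a₁) (ν : Stage7Numerics) (hM₁ : 0 < ν.M₁) {M : ℕ} (hM : 1 ≤ M) (g : ℕ → ℝ) (K k : ℕ) (hk : 1 ≤ k) :
    ∃ (s : SeqOfRecord F ν M g K k) (ε δ : ℕ → ℝ) (W : MSField (F.P K) (SU N)) (U : GaugeField (F.P K) 0 (SU N)),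
      Sect2.SeqSeparated ν.M₁ s ∧ 0 < ν.M₁ ∧ 1 ≤ k ∧
      (∀ n, n ≤ k → 0 < δ n ∧ δ n ≤ a₁) ∧ (∀ n, n < k → δ n ≤ 2 * δ (n + 1)) ∧ (∀ n, n < k → δ (n + 1) ≤ 2 * δ n) ∧
      (∀ n, n ≤ k → B₃ * δ n ≤ ε n ∧ ε n ≤ a₀) ∧ (∀ n, n < k → ε n ≤ 2 * ε (n + 1)) ∧ (∀ n, n < k → ε (n + 1) ≤ 2 * ε n) ∧
      Sect2.DataSmall7PTop (avOfRecord F N K) s.Ω (Sup ν K s.Ω) k δ W ∧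
      (∀ n, n ≤ k → PlaqSmallOn (Sect2.omegaPlaqsTop s.Ω (Sup ν K s.Ω) n) (ε n * (F.P K).eta n ^ 2) U) ∧
      (∀ n, n ≤ k → Sect2.CoDivSmallOn (Sect2.omegaBondsTop s.Ω (Sup ν K s.Ω) n) (ε n * (F.P K).eta n ^ 3) U) ∧
      AgreeOn (genSet s.Ω k) (avgFamily (avOfRecord F N K) U) W ∧ IsCritOnFibre F N K (genSet s.Ω k) W U ∧
      ((∀ n, n ≤ k → ∀ p ∈ Sect2.omegaPlaqsTop s.Ω (Sup ν K s.Ω) n, p ∉ Sect2.printedPlaqs s.Ω k 0 →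
          dist1 (GaugeField.plaqHol U p) < max (B₃ * δ n) (ε n / 2) * (F.P K).eta n ^ 2) ∧
        ∀ n, n ≤ k → ∀ b ∈ Sect2.omegaBondsTop s.Ω (Sup ν K s.Ω) n, b ∉ Sect2.bondsDeep (s.Ω 1)ᶜ →
          ‖Sect2.coDivSum U b.src b.dir‖ < max (B₃ * δ n) (ε n / 2) * (F.P K).eta n ^ 3) := by
  obtain ⟨s, ε, δ, W, U, hsep, hM₁', hk', hδ, hc, hc', hε, hec, hec', h7, h17, h19, hfib, hcrit, hP, hD⟩ :=
    halvingStepTop_binders_inhabited_flat F N Sup hB₃ ha₀ ha₁ ν hM₁ hM g K k hk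
  exact ⟨s, ε, δ, W, U, hsep, hM₁', hk', hδ, hc, hc', hε, hec, hec', h7, h17, h19, hfib, hcrit,
    fun n hn p hp _ => hP n hn p hp, fun n hn b hb _ => hD n hn b hb⟩

end Witness

end Summit.QuantumFields.YangMills.Theorems.K0HalvingStepOfCore

end
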